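import Literature.Analysis.FluidPDE.FluidComputer.ThresholdLevelTableU
import HarnessLib

/-!
# Kernel run of the re-cut table over the 10⁻² box, chunks 60 … 63 (bp3 gen 13, layer 4: robustness variant U)

HONEST FRAMING: low prior, high value-of-information experiment on Tao's machine paradigm; NOT a
claim that NS blows up.

Four kernel evaluations (`decide +kernel`; no `native_decide`, no extra axioms) of the checker
`runSteps` (`ThresholdLevelCheck.lean`) with the interval gate data `GIu` (all seven data within
relative `10⁻²`) on ≤ 25 steps of `ThresholdLevelTableU.stepsU` at a time, from `Bu i` towards the next chunk's
first level, returning `Bu (i+1)` (`Bu 0 = ThresholdLevelTable.Bc0`).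
-/

namespace Literature.Analysis.FluidPDE.FluidComputer

namespace ThresholdLevelTableU

open ThresholdLevelTable (Bc0 RbIt)

set_option maxHeartbeats 10000000 in
set_option maxRecDepth 200000 in
/-- Chunk 60 of the re-cut table run over the 10⁻² box (steps 1500 … 1524). [folklore] -/
theorem runU60 : runSteps 60 12 3 GIu RbIt Bu60 chunkU60 95233360970979792 = some Bu61 := by
  decide +kernel

set_option maxHeartbeats 10000000 in
set_option maxRecDepth 200000 in
/-- Chunk 61 of the re-cut table run over the 10⁻² box (steps 1525 … 1549). [folklore] -/
theorem runU61 : runSteps 60 12 3 GIu RbIt Bu61 chunkU61 103893849590411248 = some Bu62 := by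
  decide +kernel

set_option maxHeartbeats 10000000 in
set_option maxRecDepth 200000 in
/-- Chunk 62 of the re-cut table run over the 10⁻² box (steps 1550 … 1574). [folklore] -/
theorem runU62 : runSteps 60 12 3 GIu RbIt Bu62 chunkU62 113343294079331032 = some Bu63 := by
  decide +kernel

set_option maxHeartbeats 10000000 in
set_option maxRecDepth 200000 in
/-- Chunk 63 of the re-cut table run over the 10⁻² box (steps 1575 … 1595). [folklore] -/
theorem runU63 : runSteps 60 12 3 GIu RbIt Bu63 chunkU63 121940513536631776 = some Bu64 := by
  decide +kernel

end ThresholdLevelTableU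

end Literature.Analysis.FluidPDE.FluidComputer
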